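import Literature.Probability.LatticeModels.IsingAutomorphismCovariance
import Literature.Probability.LatticeModels.FreeStateGibbs
import Literature.Probability.Percolation.SiteConnectionTools
import HarnessLib

/-!
# Invariance of the plus and minus states under the point symmetries of `ℤ^d`

Topic `Probability/LatticeModels`; theorems only. Georgii–Higuchi 2000, §2 (p. 3) list among the
basic facts "the pure phases `μ⁺, μ⁻ ∈ 𝒢` obtained as limits for `Λ ↑ ℤ²` of `μ^ω_Λ` with
`ω ≡ +1` resp. `-1`, their invariance under all graph automorphisms of `ℤ²`". Translation invariance
is in the tree (`exists_plusMeasure_holds`); here we add the **signed coordinate permutations**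
(`Percolation.zdSignedPermIso π ε`: reflections in the coordinate hyperplanes, coordinate
permutations, hence all lattice rotations fixing the origin), which map the centred boxes `B(L)`
onto themselves:

* `box_map_signedPerm` — `φ(B(L)) = B(L)`;
* `spinProduct_comp_configRelabel`, `spinCorr_map_configRelabel` — `σ_A ∘ R_φ = σ_{φ⁻¹ A}`;
* `isingCorr_box_plus_map_signedPerm_symm`, `plusCorr_map_signedPerm_symm` (and `minus`) —
  `⟨σ_{φ⁻¹A}⟩⁺_{B(L)} = ⟨σ_A⟩⁺_{B(L)}` (covariance `isingExpect_fixed_relabel` with the invariant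
  volume `B(L)` and the invariant boundary condition `±1`), hence `⟨σ_{φ⁻¹A}⟩^± = ⟨σ_A⟩^±`;
* **`map_configRelabel_signedPerm_eq_of_spinCorr_eq_plusCorr`** (and `minusCorr`) — a probability
  measure with the `±` correlations is invariant under `R_φ` (correlations determine the measure,
  Friedli–Velenik 2017, Lemma 3.19).
* `reflectCoord i` — the reflection `x_i ↦ -x_i` of `ℤ^d` as a graph automorphism, an involution.

## References

* H.-O. Georgii, Y. Higuchi, J. Math. Phys. 41 (2000) 1153–1169, §2, p. 3 [GeorgiiHiguchi2000].
* S. Friedli, Y. Velenik, *Statistical Mechanics of Lattice Systems*, CUP 2017, Thm. 3.17 (2),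
  Lemma 3.19 [FriedliVelenik2017].
-/

noncomputable section

open MeasureTheory Finset Filter
open Literature.Probability.Percolation (zdSignedPermIso signedPerm_image_box)

namespace Literature.Probability.LatticeModels

/-! ### Spin products under relabelling -/

section Relabel

variable {V : Type*}

/-- `σ_A(R_φ σ) = σ_{φ⁻¹ A}(σ)`: relabelling the configuration relabels the index set of a spin
product. [cite: GeorgiiHiguchi2000, §2 p. 3] -/
theorem spinProduct_comp_configRelabel (φ : V ≃ V) (A : Finset V) (σ : SpinConfig V) :
    spinProduct A (configRelabel φ σ) = spinProduct (A.map φ.symm.toEmbedding) σ := by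
  unfold spinProduct
  rw [Finset.prod_map]
  refine Finset.prod_congr rfl fun x _ => ?_
  simp [spinAt]

/-- Correlations of the relabelled measure: `⟨σ_A⟩_{μ∘R_φ⁻¹} = ⟨σ_{φ⁻¹A}⟩_μ`. [cite: GeorgiiHiguchi2000, §2 p. 3] -/
theorem spinCorr_map_configRelabel (μ : Measure (SpinConfig V)) (φ : V ≃ V) (A : Finset V) :
    spinCorr (μ.map (configRelabel φ)) A = spinCorr μ (A.map φ.symm.toEmbedding) := by
  rw [spinCorr, spinCorr, integral_map_equiv]
  exact integral_congr_ae (Eventually.of_forall fun σ => spinProduct_comp_configRelabel φ A σ)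

end Relabel

/-! ### Signed permutations preserve boxes and the `±` states -/

section Zd

variable {d : ℕ} {β h : ℝ}

/-- `φ(B(L)) = B(L)` for a signed coordinate permutation `φ`, as an equality of finsets. [folklore] -/
theorem box_map_signedPerm (π : Equiv.Perm (Fin d)) (ε : Fin d → ℤˣ) (L : ℕ) :
    (box d L).map (Site.signedPerm π ε).toEmbedding = box d L :=
  Finset.coe_injective (by rw [Finset.coe_map, Equiv.coe_toEmbedding, signedPerm_image_box])

/-- The constant configurations are invariant under relabelling. [folklore] -/
theorem configRelabel_const {V : Type*} (φ : V ≃ V) (c : ℤˣ) :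
    configRelabel φ (fun _ : V => c) = fun _ => c := rfl

/-- **Finite-volume `+` correlations in a box are invariant under signed permutations**:
`⟨σ_{φ⁻¹A}⟩⁺_{B(L);β,h} = ⟨σ_A⟩⁺_{B(L);β,h}` (covariance `isingExpect_fixed_relabel`, `φ(B(L)) = B(L)`,
`R_φ 1 = 1`). [cite: FriedliVelenik2017, Thm. 3.17] -/
theorem isingCorr_box_plus_map_signedPerm_symm (π : Equiv.Perm (Fin d)) (ε : Fin d → ℤˣ) (L : ℕ)
    (β h : ℝ) (A : Finset (Site d)) :
    isingCorr (zdGraph d) (box d L) β h .plus (A.map (Site.signedPerm π ε).symm.toEmbedding) =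
      isingCorr (zdGraph d) (box d L) β h .plus A := by
  have key := isingExpect_fixed_relabel (zdGraph d) (zdSignedPermIso π ε) (box d L) β h
    (fun _ => (1 : ℤˣ)) (measurable_spinProduct A)
  change isingExpect (zdGraph d) ((box d L).map (Site.signedPerm π ε).toEmbedding) β h
      (.fixed (configRelabel (Site.signedPerm π ε) fun _ => 1)) (spinProduct A) =
    isingExpect (zdGraph d) (box d L) β h (.fixed fun _ => 1)
      (spinProduct A ∘ configRelabel (Site.signedPerm π ε)) at key
  rw [box_map_signedPerm, configRelabel_const] at key
  have hcomp : spinProduct A ∘ configRelabel (Site.signedPerm π ε) =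
      spinProduct (A.map (Site.signedPerm π ε).symm.toEmbedding) :=
    funext fun σ => spinProduct_comp_configRelabel _ A σ
  rw [hcomp] at key
  exact key.symm

/-- **Finite-volume `-` correlations in a box are invariant under signed permutations.** [cite: FriedliVelenik2017, Thm. 3.17] -/
theorem isingCorr_box_minus_map_signedPerm_symm (π : Equiv.Perm (Fin d)) (ε : Fin d → ℤˣ) (L : ℕ)
    (β h : ℝ) (A : Finset (Site d)) :
    isingCorr (zdGraph d) (box d L) β h .minus (A.map (Site.signedPerm π ε).symm.toEmbedding) =
      isingCorr (zdGraph d) (box d L) β h .minus A := by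
  have key := isingExpect_fixed_relabel (zdGraph d) (zdSignedPermIso π ε) (box d L) β h
    (fun _ => (-1 : ℤˣ)) (measurable_spinProduct A)
  change isingExpect (zdGraph d) ((box d L).map (Site.signedPerm π ε).toEmbedding) β h
      (.fixed (configRelabel (Site.signedPerm π ε) fun _ => -1)) (spinProduct A) =
    isingExpect (zdGraph d) (box d L) β h (.fixed fun _ => -1)
      (spinProduct A ∘ configRelabel (Site.signedPerm π ε)) at key
  rw [box_map_signedPerm, configRelabel_const] at key
  have hcomp : spinProduct A ∘ configRelabel (Site.signedPerm π ε) =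
      spinProduct (A.map (Site.signedPerm π ε).symm.toEmbedding) :=
    funext fun σ => spinProduct_comp_configRelabel _ A σ
  rw [hcomp] at key
  exact key.symm

/-- **`⟨σ_{φ⁻¹A}⟩⁺_{β,h} = ⟨σ_A⟩⁺_{β,h}`**: the plus state is invariant under signed coordinate
permutations (Friedli–Velenik 2017, Thm. 3.17 (2); Georgii–Higuchi 2000, §2 p. 3). [cite: GeorgiiHiguchi2000, §2 p. 3] -/
theorem plusCorr_map_signedPerm_symm (π : Equiv.Perm (Fin d)) (ε : Fin d → ℤˣ) (β h : ℝ)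
    (A : Finset (Site d)) :
    plusCorr d β h (A.map (Site.signedPerm π ε).symm.toEmbedding) = plusCorr d β h A := by
  show limUnder atTop (fun L : ℕ => isingCorr (zdGraph d) (box d L) β h .plus
      (A.map (Site.signedPerm π ε).symm.toEmbedding)) =
    limUnder atTop (fun L : ℕ => isingCorr (zdGraph d) (box d L) β h .plus A)
  congr 1
  funext L
  exact isingCorr_box_plus_map_signedPerm_symm π ε L β h A

/-- **`⟨σ_{φ⁻¹A}⟩⁻_{β,h} = ⟨σ_A⟩⁻_{β,h}`**: the minus state is invariant under signed coordinate
permutations. [cite: GeorgiiHiguchi2000, §2 p. 3] -/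
theorem minusCorr_map_signedPerm_symm (π : Equiv.Perm (Fin d)) (ε : Fin d → ℤˣ) (β h : ℝ)
    (A : Finset (Site d)) :
    minusCorr d β h (A.map (Site.signedPerm π ε).symm.toEmbedding) = minusCorr d β h A := by
  show limUnder atTop (fun L : ℕ => isingCorr (zdGraph d) (box d L) β h .minus
      (A.map (Site.signedPerm π ε).symm.toEmbedding)) =
    limUnder atTop (fun L : ℕ => isingCorr (zdGraph d) (box d L) β h .minus A)
  congr 1
  funext L
  exact isingCorr_box_minus_map_signedPerm_symm π ε L β h A

/-- **A probability measure with the plus correlations is invariant under the signed coordinate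
permutations of `ℤ^d`** (in particular `μ⁺ ∘ R⁻¹ = μ⁺` for every reflection `R` in a coordinate
hyperplane; Georgii–Higuchi 2000, §2 p. 3). [cite: GeorgiiHiguchi2000, §2 p. 3] -/
theorem map_configRelabel_signedPerm_eq_of_spinCorr_eq_plusCorr (π : Equiv.Perm (Fin d))
    (ε : Fin d → ℤˣ) (μ : Measure (SpinConfig (Site d))) [IsProbabilityMeasure μ]
    (hp : ∀ A : Finset (Site d), spinCorr μ A = plusCorr d β h A) :
    μ.map (configRelabel (Site.signedPerm π ε)) = μ := by
  haveI : IsProbabilityMeasure (μ.map (configRelabel (Site.signedPerm π ε))) :=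
    Measure.isProbabilityMeasure_map (configRelabel _).measurable.aemeasurable
  refine measure_eq_of_forall_spinCorr_eq _ _ fun A => ?_
  rw [spinCorr_map_configRelabel, hp, hp, plusCorr_map_signedPerm_symm]

/-- **A probability measure with the minus correlations is invariant under the signed coordinate
permutations of `ℤ^d`.** [cite: GeorgiiHiguchi2000, §2 p. 3] -/
theorem map_configRelabel_signedPerm_eq_of_spinCorr_eq_minusCorr (π : Equiv.Perm (Fin d))
    (ε : Fin d → ℤˣ) (μ : Measure (SpinConfig (Site d))) [IsProbabilityMeasure μ]
    (hm : ∀ A : Finset (Site d), spinCorr μ A = minusCorr d β h A) :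
    μ.map (configRelabel (Site.signedPerm π ε)) = μ := by
  haveI : IsProbabilityMeasure (μ.map (configRelabel (Site.signedPerm π ε))) :=
    Measure.isProbabilityMeasure_map (configRelabel _).measurable.aemeasurable
  refine measure_eq_of_forall_spinCorr_eq _ _ fun A => ?_
  rw [spinCorr_map_configRelabel, hm, hm, minusCorr_map_signedPerm_symm]

/-! ### Coordinate reflections -/

/-- The signs flipping the `i`-th coordinate. [folklore] -/
def reflectSigns (i : Fin d) : Fin d → ℤˣ := fun j => if j = i then -1 else 1

/-- The **reflection in the coordinate hyperplane `{x_i = 0}`**, `x ↦ (x_1, …, -x_i, …, x_d)`, as an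
automorphism of `ℤ^d` (Georgii–Higuchi 2000, §2 p. 3: `R_hor`, `R_vert` for `d = 2`). [cite: GeorgiiHiguchi2000, §2 p. 3] -/
def reflectCoord (i : Fin d) : zdGraph d ≃g zdGraph d := zdSignedPermIso (Equiv.refl _) (reflectSigns i)

/-- Coordinates of the reflected site. [cite: GeorgiiHiguchi2000, §2 p. 3] -/
theorem reflectCoord_apply (i : Fin d) (x : Site d) (j : Fin d) :
    reflectCoord i x j = if j = i then -x j else x j := by
  change Site.signedPerm (Equiv.refl _) (reflectSigns i) x j = _
  rw [Site.signedPerm_apply]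
  by_cases hj : j = i
  · simp [reflectSigns, hj]
  · simp [reflectSigns, hj]

/-- Coordinate reflections are involutions. [cite: GeorgiiHiguchi2000, §2 p. 3] -/
theorem reflectCoord_reflectCoord (i : Fin d) (x : Site d) : reflectCoord i (reflectCoord i x) = x := by
  funext j
  rw [reflectCoord_apply, reflectCoord_apply]
  by_cases hj : j = i <;> simp [hj]

/-- The underlying bijection of `reflectCoord i` is the signed permutation with trivial
permutation and signs `reflectSigns i`. [cite: GeorgiiHiguchi2000, §2 p. 3] -/
theorem reflectCoord_toEquiv (i : Fin d) :
    (reflectCoord i).toEquiv = Site.signedPerm (Equiv.refl _) (reflectSigns (d := d) i) := rfl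

/-- Coordinate reflections preserve the centred boxes. [cite: GeorgiiHiguchi2000, §2 p. 3] -/
theorem box_map_reflectCoord (i : Fin d) (L : ℕ) :
    (box d L).map (reflectCoord i).toEquiv.toEmbedding = box d L :=
  box_map_signedPerm _ _ L

end Zd

end Literature.Probability.LatticeModels
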